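import Literature.Probability.RandomPlanarGeometry.RestrictionDerivOuter
import HarnessLib

/-!
# Thin `*`-hulls along the real axis, off `0` and `∞`, have restriction derivative close to `1`
# (piece (G6‴) of stub 5a4′ `stub_carvedReduction_squeeze`)

Piece of stub 5a4′ `stub_carvedReduction_squeeze` (`TwoPieceAdmRestrictionLimit → MovingCarvingSqueeze`)
of the line `bridge-gate-renewal` (r8) of the crux `SAWDefectDecoherence.ObservableToSLER`
(stmt-CriticalPhenomena-14005; twin T2b′ of stmt-CriticalPhenomena-10472), item (G6) of its audit,
EXCISION STEP.  A realised gate level may carry lattice hexagons of positive limit size hanging on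
the rest of the carving through necks of vanishing width (one corner cell); every fixed outer
Jordan approximant of the moving carved domains swallows such a piece (its carved neighbours fill
an annulus around it), so its Carathéodory kernel contains the piece and the plain inner/outer
sandwich loses the factor `P[SLE_{8/3} avoids the piece] < 1`.  The loss is recovered by EXCISING
the core of the piece from the outer approximant together with a short thin channel through the
neck into the (excluded) core of the carving it hangs on, at the price of the mass of walks of the
super-domain family touching the channel, which ARL″ computes as `1 − d^{5/8}` with `d` the
restriction derivative of the channel's hull — a THIN hull along the real axis, off `0` and `∞`,
in half-plane coordinates.  This file proves that such hulls have `d ≥ 1 − ε`: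

* `stub_carvedReduction_thinHullDeriv` — for `0 < r'`, `R'` and `ε > 0` there is `θ > 0` such
  that every `*`-hull `H ⊆ {z | im z ≤ θ ∧ r' ≤ ‖z‖ ≤ R'}` and every restriction datum `(Ψ, e)` of
  `H` satisfy `1 − ε ≤ e` ([LSW] §2: the `±`-parts of `H` lie in two thin boxes, hence in a
  half-ellipse hull and its mirror image, whose derivative `ellDeriv → 1`; antitonicity and the
  union bound `1 − Φ'_H(0) ≤ (1 − Φ'_{H₊}(0)) + (1 − Φ'_{H₋}(0))`).  It is the case `A = ∅` of the
  outer continuity `HasRestrictionDeriv.exists_forall_outer_ge` / of the twin's collar form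
  `TypeLadder.stub_carvedReduction_collarDeriv` (p128980), which both require `A ≠ ∅`.

Sources: G. F. Lawler, O. Schramm, W. Werner, J. Amer. Math. Soc. 16 (2003) §2 (2.4) p. 7, p. 8
(Semigroups, `±`-hulls), Prop. 4.1.
-/

noncomputable section

open Set Filter Metric Bornology Function Complex
open _root_.Topology
open UpperHalfPlane (upperHalfPlaneSet isOpen_upperHalfPlaneSet)
open scoped ComplexConjugate
open Literature.Probability.RandomPlanarGeometry

namespace Summit.CriticalPhenomena.SAWScalingLimit.Theorems.ObservableToSLER.Squeeze

/-- **Registered sub-goal `stub_carvedReduction_thinHullDeriv`** (crux item stmt-CriticalPhenomena-14005,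
stub 5a4′ `stub_carvedReduction_squeeze`, piece (G6‴) THIN HULLS HAVE DERIVATIVE CLOSE TO ONE): for
`0 < r'`, an outer radius `R'` and `ε > 0` there is `θ > 0` such that every `*`-hull
`H ⊆ {z | im z ≤ θ ∧ r' ≤ ‖z‖ ∧ ‖z‖ ≤ R'}` and every restriction datum `(Ψ, e)` of `H` have
`1 − ε ≤ e`. [cite: LawlerSchrammWerner2003Restriction, §2 (2.4) p. 7 with p. 8 (Semigroups, ±-hulls)] -/
theorem stub_carvedReduction_thinHullDeriv :
    ∀ (r' R' ε : ℝ), 0 < r' → 0 < ε → ∃ θ > (0 : ℝ),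
      ∀ (H : Set ℂ) (Ψ : ConformalEquiv (upperHalfPlaneSet \ H) upperHalfPlaneSet) (e : ℝ),
        IsStarHull H → H ⊆ {z : ℂ | z.im ≤ θ ∧ r' ≤ ‖z‖ ∧ ‖z‖ ≤ R'} →
        IsRestrictionMap H Ψ → HasRestrictionDeriv H Ψ e → 1 - ε ≤ e := by
  intro r' R' ε hr' hε
  classical
  -- the ellipse parameters: boxes `{r'/2 ≤ |re| ≤ R'', 0 ≤ im ≤ θ}` inside `ellHull a b ρ`
  set R'' : ℝ := max R' r' with hR''
  set a : ℝ := r' / 4 with ha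
  set b : ℝ := R'' + 1 with hb
  have ha0 : 0 < a := by positivity
  have hab : a < b := by
    rw [ha, hb]; linarith [le_max_right R' r']
  obtain ⟨ρ, hρ0, hρ1, hBρ, hρd⟩ := exists_rho_ellDeriv_gt hab ha0 (half_pos hε)
  have hθ₁ : 0 < ellH a b * (jLevel ρ - 2) := mul_pos (ellH_pos hab) (by linarith [two_lt_jLevel hρ0 hρ1])
  set θ : ℝ := min (ellH a b * (jLevel ρ - 2) / 2) (r' / 2) with hθ
  have hθ0 : 0 < θ := lt_min (by positivity) (by positivity)
  refine ⟨θ, hθ0, fun H Ψ e hH hHsub hΨ he => ?_⟩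
  -- the two thin boxes
  set P : Set ℂ := Icc (r' / 2) R'' ×ℂ Icc 0 θ with hP
  set N : Set ℂ := imagAxisRefl '' P with hN
  have hHPN : H ⊆ P ∪ N := by
    intro z hz
    obtain ⟨hzim, hzr, hzR⟩ := hHsub hz
    have hzim0 : 0 ≤ z.im := hH.isBoundedHull.im_nonneg hz
    have hθr : θ ≤ r' / 2 := min_le_right _ _
    -- `|re z| ≥ r'/2` since `‖z‖ ≥ r'` and `im z ≤ θ ≤ r'/2`
    have hre : r' / 2 ≤ |z.re| := by
      have h1 : r' ^ 2 ≤ z.re ^ 2 + z.im ^ 2 := by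
        have := Complex.sq_norm z
        rw [Complex.normSq_apply] at this
        nlinarith
      have h2 : z.im ^ 2 ≤ (r' / 2) ^ 2 := by nlinarith
      have h3 : (r' / 2) ^ 2 ≤ z.re ^ 2 := by nlinarith
      nlinarith [sq_abs z.re, abs_nonneg z.re]
    have hreR : |z.re| ≤ R'' := ((abs_re_le_norm _).trans hzR).trans (le_max_left _ _)
    rcases le_or_gt 0 z.re with hpos | hneg
    · left
      rw [abs_of_nonneg hpos] at hre hreR
      exact ⟨⟨hre, hreR⟩, hzim0, hzim⟩
    · right
      rw [abs_of_neg hneg] at hre hreR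
      refine ⟨imagAxisRefl z, ⟨⟨?_, ?_⟩, ?_, ?_⟩, imagAxisRefl_imagAxisRefl _⟩
      · simpa using hre
      · simpa using hreR
      · simpa using hzim0
      · simpa using hzim
  -- the two half-ellipse hulls
  have hθe : θ < ellH a b * (jLevel ρ - 2) := lt_of_le_of_lt (min_le_left _ _) (by linarith)
  have hPE : P ⊆ ellHull a b ρ :=
    reProdIm_subset_ellHull hab (by rw [ha]; linarith) (by rw [hb]; linarith) hθe
  have hE : IsStarHull (ellHull a b ρ) := isStarHull_ellHull hab hρ0 hρ1 hBρ
  have hEm : IsStarHull (imagAxisRefl '' ellHull a b ρ) := hE.image_imagAxisRefl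
  have hNE : N ⊆ imagAxisRefl '' ellHull a b ρ := image_mono hPE
  have hEre : ∀ w ∈ ellHull a b ρ, 0 < w.re := fun w hw => re_pos_of_mem_ellHull hab hBρ hw
  have hEmre : ∀ w ∈ imagAxisRefl '' ellHull a b ρ, w.re < 0 := by
    rintro _ ⟨w, hw, rfl⟩
    rw [imagAxisRefl_re]
    linarith [hEre w hw]
  -- the `±`-parts of `H`
  obtain ⟨hHp, hHm, hHunion, -, -, -⟩ :=
    hH.sidePart_decomposition hH.isBoundedHull.isConnected_union_im_nonpos
  have hside : ∀ {s : ℝ}, s = 1 ∨ s = -1 → ∀ q ∈ sidePart H s,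
      (s = 1 → q ∈ ellHull a b ρ) ∧ (s = -1 → q ∈ imagAxisRefl '' ellHull a b ρ) := by
    intro s hs q hq
    obtain ⟨C, hCQ, hCconn, hqC, x, hx, hxC⟩ := exists_isPreconnected_of_mem_sidePart hq
    have hCsub : C ⊆ H := hCQ.trans (sidePart_subset H s)
    have hCuv : C ⊆ {w : ℂ | 0 < w.re} ∪ {w : ℂ | w.re < 0} := fun w hw => by
      rcases hHPN (hCsub hw) with h | h
      · exact Or.inl (hEre w (hPE h))
      · exact Or.inr (hEmre w (hNE h))
    have hdisj : Disjoint {w : ℂ | 0 < w.re} {w : ℂ | w.re < 0} :=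
      Set.disjoint_left.2 fun w h1 h2 => by simp only [mem_setOf_eq] at h1 h2; linarith
    have ho1 : IsOpen {w : ℂ | 0 < w.re} := isOpen_lt continuous_const continuous_re
    have ho2 : IsOpen {w : ℂ | w.re < 0} := isOpen_lt continuous_re continuous_const
    constructor
    · intro hs1
      subst hs1
      have hxpos : 0 < x := by simpa using hx
      have hCleft : C ⊆ {w : ℂ | 0 < w.re} :=
        hCconn.subset_left_of_subset_union ho1 ho2 hdisj hCuv ⟨x, hxC, by simpa using hxpos⟩
      rcases hHPN (hCsub hqC) with h | h
      · exact hPE h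
      · exact absurd (hCleft hqC) (by simp only [mem_setOf_eq, not_lt]; exact (hEmre q (hNE h)).le)
    · intro hs1
      subst hs1
      have hxneg : x < 0 := by simpa using hx
      have hCright : C ⊆ {w : ℂ | w.re < 0} :=
        hCconn.subset_right_of_subset_union ho1 ho2 hdisj hCuv ⟨x, hxC, by simpa using hxneg⟩
      rcases hHPN (hCsub hqC) with h | h
      · exact absurd (hCright hqC) (by simp only [mem_setOf_eq, not_lt]; exact (hEre q (hPE h)).le)
      · exact hNE h
  have hHpE : sidePart H 1 ⊆ ellHull a b ρ := fun q hq => (hside (Or.inl rfl) q hq).1 rfl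
  have hHmE : sidePart H (-1) ⊆ imagAxisRefl '' ellHull a b ρ := fun q hq => (hside (Or.inr rfl) q hq).2 rfl
  -- restriction data of the parts and of the ellipse hulls
  obtain ⟨Ψp, hΨp, -⟩ := IsStarHull.existsUnique_isRestrictionMap_holds hHp.1
  obtain ⟨dp, -, -, hdp⟩ := IsStarHull.exists_hasRestrictionDeriv_holds hHp.1 hΨp
  obtain ⟨Ψm, hΨm, -⟩ := IsStarHull.existsUnique_isRestrictionMap_holds hHm.1
  obtain ⟨dm, -, -, hdm⟩ := IsStarHull.exists_hasRestrictionDeriv_holds hHm.1 hΨm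
  have hdataE := hasRestrictionDeriv_ellConf hab hρ0 hρ1 hBρ
  have hmapE := isRestrictionMap_ellConf hab hρ0 hρ1 hBρ
  obtain ⟨ΨEm, hΨEm, hdEm⟩ := exists_restrictionData_of_image rfl (ellConf hab hρ0 hρ1.le hBρ) hmapE hdataE
  -- the bounds
  have hp : ellDeriv a b ρ ≤ dp := hdataE.le_of_subset hE hHp.1 hHpE hmapE hΨp hdp
  have hm : ellDeriv a b ρ ≤ dm := hdEm.le_of_subset hEm hHm.1 hHmE hΨEm hΨm hdm
  have hunion : 1 - e ≤ (1 - dp) + (1 - dm) :=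
    HasRestrictionDeriv.one_sub_le_add hHp.1 hHm.1 hH hHunion hΨp hΨm hΨ hdp hdm he
  linarith

end Summit.CriticalPhenomena.SAWScalingLimit.Theorems.ObservableToSLER.Squeeze

end
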